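import Mathlib
import HarnessLib
import Literature.Analysis.FluidPDE.WholeSpaceIBP
import Literature.Analysis.FluidPDE.HeatDuhamelBack

/-!
# Item `LrcModEntire` (stmt-NavierStokesRegularity-20428), skeleton twist_split v6 — T1 cell, step (I), lemma (L3):
# ONE-SIGNED ENTIRE SOLUTIONS OF THE HELMHOLTZ EQUATION VANISH

Cell ns-regularity-ideate, seat ns-k2-port-2 g4 (free hand after the signed/(BRANCH) road; `--supports stmt-NavierStokesRegularity-20428 --as helper`; ask of the
LEAD ns-poloidal-K2-p3 g13, STATUS 2026-08-29T04:55:55Z and crux memo CELLS-TH-g13 §2ter, case `μ₀ > 0` of the planar Liouville package: `Δφ = (κ − φ)/μ₀ ≥ 0`,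
so `ψ := φ − κ ≤ 0` solves the HELMHOLTZ equation `Δψ + k²ψ = 0`, `k² = 1/μ₀`).

* `helmholtzLiouville_of_nonpos` — `E` a finite-dimensional real inner product space (any dimension `n`), `ψ ∈ C²(E)`, `Δψ = −k²·ψ` pointwise with `k² > 0`,
  `ψ ≤ 0` everywhere ⇒ `ψ ≡ 0` (and `helmholtzLiouville_of_nonneg`, the mirror statement).
  PROOF (the LEAD's positivity test function): for a centre `x₀` take `χ(x) = m(x)³`, `m = (R² − ‖x − x₀‖²)₊`, with `96k²R² > (6n+24)²` (`n = 3`: `R² > 18.375/k²`).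
  `χ ∈ C²_c`, and `Δχ + k²χ = m·(k²m² − (6n+24)m + 24R²) ≥ 0` everywhere (negative discriminant), `> 0` at `x₀`.  Green's identity in the form
  `∫ (ψΔχ − χΔψ) = Σᵢ ∫ ∂ᵢ(ψ∂ᵢχ) − ∫ ∂ᵢ(χ∂ᵢψ) = 0` (`Literature…WholeSpaceIBP.integral_fderiv_apply_eq_zero`) gives `∫ ψ·(Δχ + k²χ) = 0` with a non-positive continuous
  compactly supported integrand, hence `ψ(x₀)·(Δχ + k²χ)(x₀) = 0`, `ψ(x₀) = 0`.
* tools: `contDiff_two_posCube` (`u ↦ (u₊)³ ∈ C²`), `laplacian_testFun` (the explicit Laplacian of `χ`), `integral_mul_laplacian_sub` (Green).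

WHAT THIS IS NOT: not a claim about Navier–Stokes regularity — a generic linear elliptic Liouville lemma for the T1 cell of the (TH) column (bears_on LADDER-NS N0,
item 20428 / crux 19708; both OPEN).
-/

noncomputable section

-- the summit and its single sub-problem share the name (CONVENTIONS §1), as in every Theorems file
set_option linter.dupNamespace false

namespace Summit.NavierStokesRegularity.NavierStokesRegularity.Theorems.PoloidalWindowDoorLrcModEntireTwistingTHHelmholtzLiouville

open Set Function Filter Topology MeasureTheory InnerProductSpace
open scoped RealInnerProductSpace InnerProductSpace Laplacian
open Literature.Analysis Literature.Analysis.FluidPDE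

/-! ### The cubed positive part `p(u) = (u₊)³` is `C²` -/

/-- `(u₊)³` has derivative `3(u₊)²`. -/
theorem hasDerivAt_posCube (u : ℝ) : HasDerivAt (fun u : ℝ => (max u 0) ^ 3) (3 * (max u 0) ^ 2) u := by
  rcases lt_trichotomy u 0 with hu | hu | hu
  · have hev : (fun v : ℝ => (max v 0) ^ 3) =ᶠ[𝓝 u] fun _ => 0 := by
      filter_upwards [Iio_mem_nhds hu] with v hv
      rw [max_eq_right hv.le]; ring
    rw [max_eq_right hu.le]
    simpa using (hasDerivAt_const u (0:ℝ)).congr_of_eventuallyEq hev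
  · subst hu
    rw [max_self]
    simp only [ne_eq, OfNat.ofNat_ne_zero, not_false_eq_true, zero_pow, mul_zero]
    rw [hasDerivAt_iff_isLittleO]
    simp only [max_self, ne_eq, OfNat.ofNat_ne_zero, not_false_eq_true, zero_pow, sub_zero, smul_zero]
    refine Asymptotics.isLittleO_iff.2 fun c hc => ?_
    filter_upwards [Metric.ball_mem_nhds (0:ℝ) (lt_min one_pos hc)] with h hh
    rw [Metric.mem_ball, dist_zero_right, Real.norm_eq_abs, lt_min_iff] at hh
    rw [Real.norm_eq_abs, Real.norm_eq_abs]
    have hm : |max h 0| ≤ |h| := by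
      rcases le_or_gt 0 h with h0 | h0
      · rw [max_eq_left h0]
      · rw [max_eq_right h0.le, abs_zero]; exact abs_nonneg h
    have hm0 : 0 ≤ |max h 0| := abs_nonneg _
    calc |max h 0 ^ 3| = |max h 0| ^ 3 := by rw [abs_pow]
      _ ≤ |h| ^ 3 := pow_le_pow_left₀ hm0 hm 3
      _ = |h| * |h| * |h| := by ring
      _ ≤ 1 * c * |h| := by
          have h1 : |h| * |h| ≤ 1 * c := mul_le_mul hh.1.le hh.2.le (abs_nonneg h) zero_le_one
          exact mul_le_mul_of_nonneg_right h1 (abs_nonneg h)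
      _ = c * |h| := by ring
  · have hev : (fun v : ℝ => (max v 0) ^ 3) =ᶠ[𝓝 u] fun v => v ^ 3 := by
      filter_upwards [Ioi_mem_nhds hu] with v hv
      rw [max_eq_left (le_of_lt hv)]
    rw [max_eq_left hu.le]
    have h := (hasDerivAt_pow 3 u)
    exact (h.congr_of_eventuallyEq hev).congr_deriv (by norm_num)

/-- `3(u₊)²` has derivative `6u₊`. -/
theorem hasDerivAt_posSq (u : ℝ) : HasDerivAt (fun u : ℝ => 3 * (max u 0) ^ 2) (6 * max u 0) u := by
  rcases lt_trichotomy u 0 with hu | hu | hu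
  · have hev : (fun v : ℝ => 3 * (max v 0) ^ 2) =ᶠ[𝓝 u] fun _ => 0 := by
      filter_upwards [Iio_mem_nhds hu] with v hv
      rw [max_eq_right hv.le]; ring
    rw [max_eq_right hu.le]
    simpa using (hasDerivAt_const u (0:ℝ)).congr_of_eventuallyEq hev
  · subst hu
    rw [max_self, mul_zero, hasDerivAt_iff_isLittleO]
    simp only [max_self, ne_eq, OfNat.ofNat_ne_zero, not_false_eq_true, zero_pow, mul_zero, sub_zero, smul_zero]
    refine Asymptotics.isLittleO_iff.2 fun c hc => ?_
    filter_upwards [Metric.ball_mem_nhds (0:ℝ) (div_pos hc (by norm_num : (0:ℝ) < 3))] with h hh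
    rw [Metric.mem_ball, dist_zero_right, Real.norm_eq_abs] at hh
    rw [Real.norm_eq_abs, Real.norm_eq_abs]
    have hm : |max h 0| ≤ |h| := by
      rcases le_or_gt 0 h with h0 | h0
      · rw [max_eq_left h0]
      · rw [max_eq_right h0.le, abs_zero]; exact abs_nonneg h
    have hm0 : 0 ≤ |max h 0| := abs_nonneg _
    calc |3 * max h 0 ^ 2| = 3 * |max h 0| ^ 2 := by rw [abs_mul, abs_pow]; norm_num
      _ ≤ 3 * |h| ^ 2 := by nlinarith [pow_le_pow_left₀ hm0 hm 2]
      _ = 3 * |h| * |h| := by ring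
      _ ≤ 3 * (c / 3) * |h| := mul_le_mul_of_nonneg_right (by nlinarith [abs_nonneg h]) (abs_nonneg h)
      _ = c * |h| := by ring
  · have hev : (fun v : ℝ => 3 * (max v 0) ^ 2) =ᶠ[𝓝 u] fun v => 3 * v ^ 2 := by
      filter_upwards [Ioi_mem_nhds hu] with v hv
      rw [max_eq_left (le_of_lt hv)]
    rw [max_eq_left hu.le]
    have h := (hasDerivAt_pow 2 u).const_mul (3:ℝ)
    exact (h.congr_of_eventuallyEq hev).congr_deriv (by norm_num; ring)

/-- **`u ↦ (u₊)³` is `C²`**, with `deriv = 3(u₊)²` and second derivative `6u₊`. -/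
theorem contDiff_two_posCube : ContDiff ℝ 2 (fun u : ℝ => (max u 0) ^ 3) := by
  have d1 : deriv (fun u : ℝ => (max u 0) ^ 3) = fun u => 3 * (max u 0) ^ 2 := funext fun u => (hasDerivAt_posCube u).deriv
  have d2 : deriv (fun u : ℝ => 3 * (max u 0) ^ 2) = fun u => 6 * max u 0 := funext fun u => (hasDerivAt_posSq u).deriv
  rw [show (2 : WithTop ℕ∞) = 1 + 1 by norm_num, contDiff_succ_iff_deriv]
  refine ⟨fun u => (hasDerivAt_posCube u).differentiableAt, by simp, ?_⟩
  rw [d1, show (1 : WithTop ℕ∞) = 0 + 1 by norm_num, contDiff_succ_iff_deriv]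
  refine ⟨fun u => (hasDerivAt_posSq u).differentiableAt, by simp, ?_⟩
  rw [d2]
  exact contDiff_zero.2 (continuous_const.mul (continuous_id.max continuous_const))

/-! ### The test function `χ(x) = ((R² − ‖x − x₀‖²)₊)³` -/

section Space

variable {E : Type*} [NormedAddCommGroup E] [InnerProductSpace ℝ E] [FiniteDimensional ℝ E]

omit [FiniteDimensional ℝ E] in
/-- `u(x) = R² − ‖x − x₀‖²` has derivative `−2⟪x − x₀, ·⟫`. -/
theorem hasFDerivAt_radial (x₀ x : E) (R : ℝ) :
    HasFDerivAt (fun y : E => R ^ 2 - ‖y - x₀‖ ^ 2) (-(2:ℝ) • innerSL ℝ (x - x₀)) x := by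
  have h1 : HasFDerivAt (fun y : E => y - x₀) (ContinuousLinearMap.id ℝ E) x := (hasFDerivAt_id x).sub_const x₀
  have h2 := h1.norm_sq
  have h3 := (hasFDerivAt_const (R ^ 2) x).sub h2
  refine h3.congr_fderiv ?_
  ext w; simp [two_smul]

omit [FiniteDimensional ℝ E] in
/-- `χ = ((R² − ‖· − x₀‖²)₊)³` is `C²`. -/
theorem contDiff_two_testFun (x₀ : E) (R : ℝ) :
    ContDiff ℝ 2 (fun y : E => (max (R ^ 2 - ‖y - x₀‖ ^ 2) 0) ^ 3) :=
  contDiff_two_posCube.comp (contDiff_const.sub ((contDiff_id.sub contDiff_const).norm_sq ℝ))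

/-- `χ` vanishes outside the closed ball `B̄(x₀, |R|)`; hence it has compact support. -/
theorem hasCompactSupport_testFun (x₀ : E) (R : ℝ) :
    HasCompactSupport (fun y : E => (max (R ^ 2 - ‖y - x₀‖ ^ 2) 0) ^ 3) := by
  refine HasCompactSupport.intro (isCompact_closedBall x₀ |R|) fun x hx => ?_
  rw [Metric.mem_closedBall, dist_eq_norm, not_le] at hx
  have h : R ^ 2 - ‖x - x₀‖ ^ 2 ≤ 0 := by
    have : |R| ^ 2 < ‖x - x₀‖ ^ 2 := by
      exact pow_lt_pow_left₀ hx (abs_nonneg R) two_ne_zero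
    rw [sq_abs] at this; linarith
  simp [max_eq_right h]

omit [FiniteDimensional ℝ E] in
/-- **First derivative of `χ`**: `Dχ(x)e = 3m² · (−2⟪x − x₀, e⟫)`, `m = (R² − ‖x − x₀‖²)₊`. -/
theorem hasFDerivAt_testFun (x₀ x : E) (R : ℝ) :
    HasFDerivAt (fun y : E => (max (R ^ 2 - ‖y - x₀‖ ^ 2) 0) ^ 3)
      ((3 * (max (R ^ 2 - ‖x - x₀‖ ^ 2) 0) ^ 2) • (-(2:ℝ) • innerSL ℝ (x - x₀))) x :=
  (hasDerivAt_posCube _).comp_hasFDerivAt x (hasFDerivAt_radial x₀ x R)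

omit [FiniteDimensional ℝ E] in
/-- The directional derivative of `χ` as a function: `y ↦ Dχ(y)e = −6 m(y)² ⟪y − x₀, e⟫`. -/
theorem fderiv_testFun_apply (x₀ : E) (R : ℝ) (e : E) :
    (fun y : E => fderiv ℝ (fun y : E => (max (R ^ 2 - ‖y - x₀‖ ^ 2) 0) ^ 3) y e) =
      fun y => -6 * (max (R ^ 2 - ‖y - x₀‖ ^ 2) 0) ^ 2 * ⟪y - x₀, e⟫_ℝ := by
  funext y
  rw [(hasFDerivAt_testFun x₀ y R).fderiv]
  simp [inner_sub_left]; ring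

omit [FiniteDimensional ℝ E] in
/-- **Second directional derivative of `χ`**: `D(y ↦ Dχ(y)e)(x)e = 24 m ⟪x−x₀,e⟫² − 6 m² ‖e‖²`. -/
theorem hasFDerivAt_fderiv_testFun (x₀ x : E) (R : ℝ) (e : E) :
    fderiv ℝ (fun y : E => fderiv ℝ (fun y : E => (max (R ^ 2 - ‖y - x₀‖ ^ 2) 0) ^ 3) y e) x e =
      24 * max (R ^ 2 - ‖x - x₀‖ ^ 2) 0 * ⟪x - x₀, e⟫_ℝ ^ 2 - 6 * (max (R ^ 2 - ‖x - x₀‖ ^ 2) 0) ^ 2 * ‖e‖ ^ 2 := by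
  rw [fderiv_testFun_apply]
  -- `y ↦ −6 m(y)² ⟪y − x₀, e⟫ = (−2⟪y−x₀,e⟫) · (3 m(y)²)`
  have hA : HasFDerivAt (fun y : E => 3 * (max (R ^ 2 - ‖y - x₀‖ ^ 2) 0) ^ 2)
      ((6 * max (R ^ 2 - ‖x - x₀‖ ^ 2) 0) • (-(2:ℝ) • innerSL ℝ (x - x₀))) x :=
    (hasDerivAt_posSq _).comp_hasFDerivAt x (hasFDerivAt_radial x₀ x R)
  have hB : HasFDerivAt (fun y : E => ⟪y - x₀, e⟫_ℝ) (innerSL ℝ e) x := by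
    have h1 : HasFDerivAt (fun y : E => y - x₀) (ContinuousLinearMap.id ℝ E) x := (hasFDerivAt_id x).sub_const x₀
    have h := h1.inner ℝ (hasFDerivAt_const e x)
    refine h.congr_fderiv ?_
    ext w; simp [real_inner_comm]
  have hfin : HasFDerivAt (fun y : E => -6 * (max (R ^ 2 - ‖y - x₀‖ ^ 2) 0) ^ 2 * ⟪y - x₀, e⟫_ℝ)
      ((-2:ℝ) • ((3 * (max (R ^ 2 - ‖x - x₀‖ ^ 2) 0) ^ 2) • innerSL ℝ e +
        ⟪x - x₀, e⟫_ℝ • ((6 * max (R ^ 2 - ‖x - x₀‖ ^ 2) 0) • (-(2:ℝ) • innerSL ℝ (x - x₀))))) x := by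
    have h := (hA.mul hB).const_mul (-2:ℝ)
    exact h.congr_of_eventuallyEq (Eventually.of_forall fun y => by simp only [Pi.mul_apply]; ring)
  rw [hfin.fderiv]
  simp [inner_sub_left]
  ring

/-- **The Laplacian of `χ`**: `Δχ(x) = 24 m ‖x−x₀‖² − 6n m²`, `n = dim E`, `m = (R² − ‖x−x₀‖²)₊`. -/
theorem laplacian_testFun (x₀ x : E) (R : ℝ) :
    (Δ (fun y : E => (max (R ^ 2 - ‖y - x₀‖ ^ 2) 0) ^ 3)) x =
      24 * max (R ^ 2 - ‖x - x₀‖ ^ 2) 0 * ‖x - x₀‖ ^ 2 - 6 * (Module.finrank ℝ E) * (max (R ^ 2 - ‖x - x₀‖ ^ 2) 0) ^ 2 := by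
  set b := stdOrthonormalBasis ℝ E
  rw [laplacian_eq_sum_fderiv_fderiv_normed b (contDiff_two_testFun x₀ R)]
  simp_rw [hasFDerivAt_fderiv_testFun]
  rw [Finset.sum_sub_distrib, ← Finset.mul_sum, ← Finset.mul_sum]
  have hsum : ∑ i, ⟪x - x₀, b i⟫_ℝ ^ 2 = ‖x - x₀‖ ^ 2 := by
    rw [← b.sum_sq_norm_inner_right (x - x₀)]
    refine Finset.sum_congr rfl fun i _ => ?_
    rw [Real.norm_eq_abs, sq_abs, real_inner_comm]
  have hone : ∑ i, ‖b i‖ ^ 2 = (Module.finrank ℝ E : ℝ) := by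
    simp [b.orthonormal.1, Finset.card_univ]
  rw [hsum, hone]
  ring

/-! ### Green's second identity for a compactly supported test function -/

variable [MeasurableSpace E] [BorelSpace E]

/-- **`∫ (ψ Δχ − χ Δψ) = 0`** for `ψ ∈ C²` and `χ ∈ C²_c` (divergence of `ψ∇χ − χ∇ψ`, term by term along an orthonormal basis). -/
theorem integral_mul_laplacian_sub {ψ χ : E → ℝ} (hψ : ContDiff ℝ 2 ψ) (hχ : ContDiff ℝ 2 χ) (hχc : HasCompactSupport χ) :
    ∫ x, (ψ x * (Δ χ) x - χ x * (Δ ψ) x) = 0 := by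
  set b := stdOrthonormalBasis ℝ E
  have hψd : Differentiable ℝ ψ := hψ.differentiable (by norm_num)
  have hχd : Differentiable ℝ χ := hχ.differentiable (by norm_num)
  have hψ1 : ∀ e : E, ContDiff ℝ 1 fun y => fderiv ℝ ψ y e := fun e => (hψ.fderiv_right (m := 1) le_rfl).clm_apply contDiff_const
  have hχ1 : ∀ e : E, ContDiff ℝ 1 fun y => fderiv ℝ χ y e := fun e => (hχ.fderiv_right (m := 1) le_rfl).clm_apply contDiff_const
  have hψ1d : ∀ e : E, Differentiable ℝ fun y => fderiv ℝ ψ y e := fun e => (hψ1 e).differentiable (by norm_num)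
  have hχ1d : ∀ e : E, Differentiable ℝ fun y => fderiv ℝ χ y e := fun e => (hχ1 e).differentiable (by norm_num)
  -- the two families of compactly supported `C¹` products
  have hA1 : ∀ e : E, ContDiff ℝ 1 fun y => ψ y * fderiv ℝ χ y e := fun e => (hψ.of_le (by norm_cast)).mul (hχ1 e)
  have hB1 : ∀ e : E, ContDiff ℝ 1 fun y => χ y * fderiv ℝ ψ y e := fun e => (hχ.of_le (by norm_cast)).mul (hψ1 e)
  have hAc : ∀ e : E, HasCompactSupport fun y => ψ y * fderiv ℝ χ y e := fun e => (hχc.fderiv_apply (𝕜 := ℝ) e).mul_left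
  have hBc : ∀ e : E, HasCompactSupport fun y => χ y * fderiv ℝ ψ y e := fun e => hχc.mul_right
  -- their directional derivatives
  have hA' : ∀ e x, fderiv ℝ (fun y => ψ y * fderiv ℝ χ y e) x e =
      fderiv ℝ ψ x e * fderiv ℝ χ x e + ψ x * fderiv ℝ (fun y => fderiv ℝ χ y e) x e := by
    intro e x
    rw [fderiv_fun_mul (hψd x) (hχ1d e x)]
    simp only [add_apply, smul_apply, smul_eq_mul]
    ring
  have hB' : ∀ e x, fderiv ℝ (fun y => χ y * fderiv ℝ ψ y e) x e =
      fderiv ℝ χ x e * fderiv ℝ ψ x e + χ x * fderiv ℝ (fun y => fderiv ℝ ψ y e) x e := by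
    intro e x
    rw [fderiv_fun_mul (hχd x) (hψ1d e x)]
    simp only [add_apply, smul_apply, smul_eq_mul]
    ring
  -- pointwise: `ψΔχ − χΔψ = Σᵢ (∂ᵢAᵢ − ∂ᵢBᵢ)`
  have hpt : ∀ x, ψ x * (Δ χ) x - χ x * (Δ ψ) x =
      ∑ i, (fderiv ℝ (fun y => ψ y * fderiv ℝ χ y (b i)) x (b i) - fderiv ℝ (fun y => χ y * fderiv ℝ ψ y (b i)) x (b i)) := by
    intro x
    rw [laplacian_eq_sum_fderiv_fderiv_normed b hχ, laplacian_eq_sum_fderiv_fderiv_normed b hψ, Finset.mul_sum, Finset.mul_sum,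
      ← Finset.sum_sub_distrib]
    refine Finset.sum_congr rfl fun i _ => ?_
    rw [hA', hB']; ring
  -- integrate term by term
  have hintA : ∀ i, Integrable fun x => fderiv ℝ (fun y => ψ y * fderiv ℝ χ y (b i)) x (b i) := fun i =>
    (((hA1 (b i)).continuous_fderiv one_ne_zero).clm_apply continuous_const).integrable_of_hasCompactSupport
      ((hAc (b i)).fderiv_apply (𝕜 := ℝ) (b i))
  have hintB : ∀ i, Integrable fun x => fderiv ℝ (fun y => χ y * fderiv ℝ ψ y (b i)) x (b i) := fun i =>
    (((hB1 (b i)).continuous_fderiv one_ne_zero).clm_apply continuous_const).integrable_of_hasCompactSupport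
      ((hBc (b i)).fderiv_apply (𝕜 := ℝ) (b i))
  have hI : (∫ x, (ψ x * (Δ χ) x - χ x * (Δ ψ) x)) =
      ∫ x, ∑ i, (fderiv ℝ (fun y => ψ y * fderiv ℝ χ y (b i)) x (b i) - fderiv ℝ (fun y => χ y * fderiv ℝ ψ y (b i)) x (b i)) :=
    integral_congr_ae (Eventually.of_forall hpt)
  have hintAB : ∀ i, Integrable fun x => fderiv ℝ (fun y => ψ y * fderiv ℝ χ y (b i)) x (b i) - fderiv ℝ (fun y => χ y * fderiv ℝ ψ y (b i)) x (b i) :=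
    fun i => (hintA i).sub (hintB i)
  rw [hI, integral_finsetSum _ fun i _ => hintAB i]
  refine Finset.sum_eq_zero fun i _ => ?_
  rw [integral_sub (hintA i) (hintB i), integral_fderiv_apply_eq_zero (hA1 (b i)) (hAc (b i)) (b i),
    integral_fderiv_apply_eq_zero (hB1 (b i)) (hBc (b i)) (b i), sub_zero]

/-! ### The Liouville theorem -/

/-- **ONE-SIGNED ENTIRE HELMHOLTZ SOLUTIONS VANISH** (non-positive version): `ψ ∈ C²(E)`, `Δψ = −k²ψ` with `k² > 0`, `ψ ≤ 0` ⇒ `ψ ≡ 0`. -/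
theorem helmholtzLiouville_of_nonpos {ψ : E → ℝ} (hψ : ContDiff ℝ 2 ψ) {ksq : ℝ} (hk : 0 < ksq)
    (heq : ∀ x, (Δ ψ) x = -ksq * ψ x) (hle : ∀ x, ψ x ≤ 0) : ∀ x, ψ x = 0 := by
  intro x₀
  set n : ℝ := (Module.finrank ℝ E : ℝ) with hn
  have hn0 : 0 ≤ n := by rw [hn]; positivity
  -- radius with negative discriminant: `96 k² R² > (6n+24)²`
  set R : ℝ := Real.sqrt ((6 * n + 24) ^ 2 / (96 * ksq) + 1) with hR
  have hR2 : R ^ 2 = (6 * n + 24) ^ 2 / (96 * ksq) + 1 := by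
    rw [hR, Real.sq_sqrt (by positivity)]
  have hdisc : (6 * n + 24) ^ 2 < 96 * ksq * R ^ 2 := by
    rw [hR2, mul_add, mul_div_cancel₀ _ (by positivity)]; nlinarith
  -- the test function and `w = Δχ + k²χ`
  set χ : E → ℝ := fun y => (max (R ^ 2 - ‖y - x₀‖ ^ 2) 0) ^ 3 with hχ
  have hχ2 : ContDiff ℝ 2 χ := contDiff_two_testFun x₀ R
  have hχc : HasCompactSupport χ := hasCompactSupport_testFun x₀ R
  -- `q(m) = k²m² − (6n+24)m + 24R² > 0` for every real `m`
  have hq : ∀ m : ℝ, 0 < ksq * m ^ 2 - (6 * n + 24) * m + 24 * R ^ 2 := by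
    intro m
    have e : ksq * m ^ 2 - (6 * n + 24) * m + 24 * R ^ 2 =
        ksq * (m - (6 * n + 24) / (2 * ksq)) ^ 2 + (96 * ksq * R ^ 2 - (6 * n + 24) ^ 2) / (4 * ksq) := by
      field_simp; ring
    rw [e]
    have h1 : 0 ≤ ksq * (m - (6 * n + 24) / (2 * ksq)) ^ 2 := by positivity
    have h2 : 0 < (96 * ksq * R ^ 2 - (6 * n + 24) ^ 2) / (4 * ksq) := div_pos (by linarith) (by positivity)
    linarith
  -- the sign of `w := Δχ + k²χ = m (k²m² − (6n+24)m + 24R²)` where `m > 0`, and `w = 0` where `m = 0`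
  have hw : ∀ x, (Δ χ) x + ksq * χ x =
      max (R ^ 2 - ‖x - x₀‖ ^ 2) 0 * (ksq * (max (R ^ 2 - ‖x - x₀‖ ^ 2) 0) ^ 2 - (6 * n + 24) * max (R ^ 2 - ‖x - x₀‖ ^ 2) 0 + 24 * R ^ 2) := by
    intro x
    rw [laplacian_testFun x₀ x R]
    simp only [hχ]
    set m := max (R ^ 2 - ‖x - x₀‖ ^ 2) 0 with hm
    rcases le_or_gt (R ^ 2 - ‖x - x₀‖ ^ 2) 0 with h0 | h0
    · have : m = 0 := by rw [hm, max_eq_right h0]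
      rw [this]; ring
    · have : ‖x - x₀‖ ^ 2 = R ^ 2 - m := by rw [hm, max_eq_left h0.le]; ring
      rw [this]; ring
  have hw0 : ∀ x, 0 ≤ (Δ χ) x + ksq * χ x := fun x => by
    rw [hw x]; exact mul_nonneg (le_max_right _ _) (hq _).le
  have hwx₀ : 0 < (Δ χ) x₀ + ksq * χ x₀ := by
    rw [hw x₀]
    have : max (R ^ 2 - ‖x₀ - x₀‖ ^ 2) 0 = R ^ 2 := by
      rw [sub_self, norm_zero]; simp [max_eq_left (sq_nonneg R)]
    rw [this]
    exact mul_pos (by rw [hR2]; positivity) (hq _)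
  -- Green: `∫ ψ·w = 0`
  have hgreen := integral_mul_laplacian_sub hψ hχ2 hχc
  have hint_id : (fun x => ψ x * (Δ χ) x - χ x * (Δ ψ) x) = fun x => ψ x * ((Δ χ) x + ksq * χ x) := by
    funext x; rw [heq x]; ring
  rw [hint_id] at hgreen
  -- the integrand `−ψ·w ≥ 0` is continuous with compact support and zero integral
  have hwcont : Continuous fun x => (Δ χ) x + ksq * χ x := by
    have h1 : Continuous fun x => max (R ^ 2 - ‖x - x₀‖ ^ 2) 0 :=
      (continuous_const.sub ((continuous_id.sub continuous_const).norm.pow 2)).max continuous_const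
    have e : (fun x => (Δ χ) x + ksq * χ x) = fun x => max (R ^ 2 - ‖x - x₀‖ ^ 2) 0 *
        (ksq * (max (R ^ 2 - ‖x - x₀‖ ^ 2) 0) ^ 2 - (6 * n + 24) * max (R ^ 2 - ‖x - x₀‖ ^ 2) 0 + 24 * R ^ 2) := funext hw
    rw [e]
    exact h1.mul (((continuous_const.mul (h1.pow 2)).sub (continuous_const.mul h1)).add continuous_const)
  have hcont : Continuous fun x => -(ψ x * ((Δ χ) x + ksq * χ x)) := (hψ.continuous.mul hwcont).neg
  have hsupp : HasCompactSupport fun x => -(ψ x * ((Δ χ) x + ksq * χ x)) := by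
    refine (HasCompactSupport.intro (isCompact_closedBall x₀ |R|) fun x hx => ?_)
    rw [Metric.mem_closedBall, dist_eq_norm, not_le] at hx
    have h : R ^ 2 - ‖x - x₀‖ ^ 2 ≤ 0 := by
      have : |R| ^ 2 < ‖x - x₀‖ ^ 2 := pow_lt_pow_left₀ hx (abs_nonneg R) two_ne_zero
      rw [sq_abs] at this; linarith
    rw [hw x, max_eq_right h]; ring
  have hnn : ∀ x, 0 ≤ -(ψ x * ((Δ χ) x + ksq * χ x)) := fun x => by
    have := mul_nonpos_of_nonpos_of_nonneg (hle x) (hw0 x)  -- ψ ≤ 0, w ≥ 0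
    linarith
  have hint : Integrable fun x => -(ψ x * ((Δ χ) x + ksq * χ x)) := hcont.integrable_of_hasCompactSupport hsupp
  have hzero : ∫ x, -(ψ x * ((Δ χ) x + ksq * χ x)) = 0 := by rw [integral_neg, hgreen, neg_zero]
  have hae : (fun x => -(ψ x * ((Δ χ) x + ksq * χ x))) =ᵐ[volume] 0 := (integral_eq_zero_iff_of_nonneg hnn hint).1 hzero
  have hfun : (fun x => -(ψ x * ((Δ χ) x + ksq * χ x))) = 0 := (hcont.ae_eq_iff_eq volume continuous_const).1 hae
  have h0 := congrFun hfun x₀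
  simp only [Pi.zero_apply, neg_eq_zero, mul_eq_zero] at h0
  exact h0.resolve_right hwx₀.ne'

/-- **ONE-SIGNED ENTIRE HELMHOLTZ SOLUTIONS VANISH** (non-negative version). -/
theorem helmholtzLiouville_of_nonneg {ψ : E → ℝ} (hψ : ContDiff ℝ 2 ψ) {ksq : ℝ} (hk : 0 < ksq)
    (heq : ∀ x, (Δ ψ) x = -ksq * ψ x) (hge : ∀ x, 0 ≤ ψ x) : ∀ x, ψ x = 0 := by
  have hneg : ∀ x, (Δ (fun y => -ψ y)) x = -ksq * (-ψ x) := by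
    intro x
    have h : (Δ (fun y => -ψ y)) x = -(Δ ψ) x := by
      have := congrFun (InnerProductSpace.laplacian_neg (f := ψ)) x
      rw [show (fun y => -ψ y) = -ψ from rfl]
      simpa using this
    rw [h, heq x]; ring
  have h := helmholtzLiouville_of_nonpos (hψ.neg) hk hneg (fun x => by linarith [hge x])
  intro x; have := h x; linarith

end Space

end Summit.NavierStokesRegularity.NavierStokesRegularity.Theorems.PoloidalWindowDoorLrcModEntireTwistingTHHelmholtzLiouville
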